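import Mathlib
import HarnessLib
import Summits.HubbardSuperconductivity.HubbardSuperconductivity.Theorems.KLProgrammeKLRegimeWickSmearingDefect
import Summits.HubbardSuperconductivity.HubbardSuperconductivity.Theorems.KLProgrammeKLRegimeSliceSymbolTorus
import Summits.HubbardSuperconductivity.HubbardSuperconductivity.Theorems.KLProgrammeSectorisedLegKernelsDefs
import Literature.MathematicalPhysics.QuantumLattice.HubbardInteractionKernels
import Literature.MathematicalPhysics.QuantumLattice.GrassmannDefectSplit

/-!
# Route `KLProgramme` — K3 gen 8 ENGINE child `KLRegimeEngineV17F2` (stmt-HubbardSuperconductivity-20437), stubs (C)/(e): LAYER 1 of the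
# REPRESENTATION EXPORT of the scale-`n` two-leg increment at a FIXED frame — exact Grassmann identities (plan g17 l.3124 (2), owner r2d-p1)

Cell gate-hubbard-kl, seat hubbard-kl-r2d-p1 (g6).  The (A)-lemma of c4a-1's C4a programme (stub (C) `stub_twoLeg_curvature`) and the B-supplier of stub (e)
both read the scale-`n` INCREMENT of the two-leg kernel of the one-shot action at a FIXED frame `K` (= the flow frame `K_n`) as «tadpole of the slice
propagator on the four-leg kernel + terms with ≥ 2 slice lines».  LAYER 1 (this file) is the algebra, carrier-level and exact; LAYER 2 (c4a-1,
`…C4aTadpoleRepresentation`) turns the tadpole into tube tadpoles + corner + aliasing in momentum space.  Notation: `𝒱_n[K] := klEffectiveAction L M β U μ K klE0 n`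
(`= hubbardEffectiveActionCT … 0 K Λ_n`, `Λ_n = klScale klE0 n`), slice covariance `S_{n+1}[K] := hubbardCovSliceCT L M β μ 0 K Λ_{n+1} Λ_n = C^K_{>Λ_{n+1}} − C^K_{>Λ_n}`.

* §1 GENERIC (any covariance `C`, any `W`, any degree `m`): **`kernel_effAction_split`** —
  `kernel (effAction C W) m X = kernel W m X + kernel (Δ_C W) m X + kernel (e^{Δ_C}W − W − Δ_C W) m X + kernel (effAction C W − e^{Δ_C}W) m X`
  (input · ONE line (tadpole/self-contraction) · ≥ 2 self-lines · ≥ 2 vertices — the last two are the remainder `R`, bounded BY NAME in the tree: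
  `sum_[wt_]norm_kernel_gaussConv_sub_le` minus its `j = 1` term, `sum_[wt_]norm_kernel_effAction_sub_gaussConv_le[_of_gramBounded]`); `kernel_effAction_sub_split`.
* §2 MODEL, one slice at fixed frame: **`klEffectiveAction_succ_eq_effAction_slice`** (`𝒱_{n+1}[K] = effAction S_{n+1}[K] 𝒱_n[K]` whenever `Z^K_{Λ_n} ≠ 0`;
  Literature `hubbardEffectiveActionCT_semigroup`); **`kernel_two_grassmannLaplacian_hubbardCovSliceCT`** — THE TADPOLE with the slice propagator AS A
  FUNCTION OF THE LEVEL: `kernel₂(Δ_{S}W)(X) = 12·Σ_{(q,σ)} ŝ(ω_q, e_K(q⃗))·kernel₄ W (X, ψ̂⁻_{qσ}, ψ̂⁺_{qσ})`, `ŝ = sliceSymbolFnXi (βL²) 0 Λ Λ'` (p1's one-loop formula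
  `kernel_grassmannLaplacian_normalCovariance'` on `hubbardCovSliceCT_eq_normalCovariance_sliceSymbolFnXi`); **`kernel_two_klEffectiveAction_succ_sub_eq`** — THE
  INCREMENT IDENTITY `kernel₂(𝒱_{n+1}[K]) − kernel₂(𝒱_n[K]) = 12·Σ ŝ_{n+1}·kernel₄(𝒱_n[K])(X,ψ̂⁻,ψ̂⁺) + kernel₂(e^{Δ_S}𝒱_n − 𝒱_n − Δ_S𝒱_n) + kernel₂(effAction S 𝒱_n − e^{Δ_S}𝒱_n)`;
  **`…_succ_sub_eq'`** — the same with the tadpole keyed on the OUTPUT `kernel₄(𝒱_{n+1}[K])`, the swap `−12·Σ ŝ·kernel₄(𝒱_{n+1} − 𝒱_n)` riding in the remainder.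
* §3 the scale-`0` BASE at fixed frame: **`kernel_two_klEffectiveAction_zero_sub_counter_eq`** —
  `kernel₂(𝒱_0[K]) − kernel₂(𝒩_K) = 12·Σ_{(q,σ)} ĉ^K_{>Λ_0}(q)·kernel₄ V_U (X,ψ̂⁻,ψ̂⁺) + (the two remainders)` (Hartree tadpole of the bare Hubbard vertex:
  `kernel (V_U + 𝒩_K) 4 = kernel V_U 4`, `kernel V_U 2 = 0`; `hubbardCovAboveCT_zero_seed`).

Everything is an EXACT identity; no estimate, no definition; nothing about the model's sizes is asserted; nothing asserts superconductivity.
References: BGM 2006 §2.2 (2.12)–(2.14), §2.3 (2.17)–(2.23) [cite: BenfattoGiulianiMastropietro2006]; Salmhofer 1999 §2.5.1 (2.106), §4.2.5 (4.70), §4.3 (4.86)–(4.95)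
[cite: Salmhofer1999].
-/

noncomputable section

namespace Summit.HubbardSuperconductivity.HubbardSuperconductivity.Theorems.KLRegimeSplit

set_option linter.dupNamespace false -- summit = problem name (single-conjunct summit), D-0017

open Finset Literature.MathematicalPhysics.QuantumLattice Literature.Probability.LatticeModels GrassmannAlgebra
open Summit.HubbardSuperconductivity.HubbardSuperconductivity.Theorems.KLProgrammeLegKernels
open Summit.HubbardSuperconductivity.HubbardSuperconductivity.Theorems.KLRegimeWick
open Summit.HubbardSuperconductivity.HubbardSuperconductivity.Theorems.TorusFourierL2

/-! ## §1 Generic: the degree-`m` kernel of one Gaussian step, split into input · one line · ≥ 2 self-lines · ≥ 2 vertices -/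

section Generic

variable {𝕜 : Type*} [RCLike 𝕜] {Γ : Type*} [Fintype Γ]

/-- **The degree-`m` kernel of `effAction C W`, split EXACTLY** into the input kernel, the ONE-LINE (self-contraction / tadpole) part `kernel (Δ_C W)`,
the `≥ 2`-self-line part `kernel (e^{Δ_C}W − W − Δ_C W)` and the `≥ 2`-vertex part `kernel (effAction C W − e^{Δ_C}W)`. -/
theorem kernel_effAction_split (C : Matrix Γ Γ 𝕜) (W : GrassmannAlgebra 𝕜 Γ) (m : ℕ) (X : Fin m → Γ) :
    kernel 𝕜 (effAction 𝕜 C W) m X =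
      kernel 𝕜 W m X + kernel 𝕜 (grassmannLaplacian 𝕜 C W) m X +
        kernel 𝕜 (gaussConv 𝕜 C W - W - grassmannLaplacian 𝕜 C W) m X +
          kernel 𝕜 (effAction 𝕜 C W - gaussConv 𝕜 C W) m X := by
  rw [kernel_sub', kernel_sub', kernel_sub']
  ring

/-- **The increment form**: `kernel (effAction C W) m X − kernel W m X = kernel (Δ_C W) m X + kernel (e^{Δ_C}W − W − Δ_C W) m X + kernel (effAction C W − e^{Δ_C}W) m X`. -/
theorem kernel_effAction_sub_split (C : Matrix Γ Γ 𝕜) (W : GrassmannAlgebra 𝕜 Γ) (m : ℕ) (X : Fin m → Γ) :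
    kernel 𝕜 (effAction 𝕜 C W) m X - kernel 𝕜 W m X =
      kernel 𝕜 (grassmannLaplacian 𝕜 C W) m X +
        kernel 𝕜 (gaussConv 𝕜 C W - W - grassmannLaplacian 𝕜 C W) m X +
          kernel 𝕜 (effAction 𝕜 C W - gaussConv 𝕜 C W) m X := by
  rw [kernel_effAction_split C W m X]
  ring

end Generic

/-! ## §2 Model: one slice at a fixed frame `K` -/

section Model

variable {L M : ℕ} [NeZero L]

/-- **One slice at a fixed frame** (semigroup in the scale): `𝒱_{n+1}[K] = effAction (C^K_{(Λ_{n+1},Λ_n]}) 𝒱_n[K]` whenever `Z^K_{Λ_n} ≠ 0`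
(Literature `hubbardEffectiveActionCT_semigroup`; any `e₀`, any frame `K`, seed `0`). -/
theorem klEffectiveAction_succ_eq_effAction_slice (β U μ : ℝ) (K : TrigPolyC4v) (e₀ : ℝ) (n : ℕ)
    (hZ : hubbardEffPartitionFnCT L M β U μ 0 K (klScale e₀ n) ≠ 0) :
    klEffectiveAction L M β U μ K e₀ (n + 1) =
      effAction ℂ (hubbardCovSliceCT L M β μ 0 K (klScale e₀ (n + 1)) (klScale e₀ n)) (klEffectiveAction L M β U μ K e₀ n) := by
  unfold klEffectiveAction
  exact hubbardEffectiveActionCT_semigroup L M β U μ 0 K (klScale e₀ (n + 1)) hZ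

/-- **Any two scales** `Λ_n` (finer) and `Λ_{n'}` (where the partition function does not vanish): `𝒱_n[K] = effAction (C^K_{(Λ_n,Λ_{n'}]}) 𝒱_{n'}[K]`. -/
theorem klEffectiveAction_eq_effAction_slice (β U μ : ℝ) (K : TrigPolyC4v) (e₀ : ℝ) (n n' : ℕ)
    (hZ : hubbardEffPartitionFnCT L M β U μ 0 K (klScale e₀ n') ≠ 0) :
    klEffectiveAction L M β U μ K e₀ n =
      effAction ℂ (hubbardCovSliceCT L M β μ 0 K (klScale e₀ n) (klScale e₀ n')) (klEffectiveAction L M β U μ K e₀ n') := by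
  unfold klEffectiveAction
  exact hubbardEffectiveActionCT_semigroup L M β U μ 0 K (klScale e₀ n) hZ

/-- **THE TADPOLE WITH THE SLICE PROPAGATOR AS A FUNCTION OF THE LEVEL** (`β ≠ 0`, any frame `K`, any two cutoffs `Λ, Λ'`, any `W`): the two-leg
kernel of `Δ_{S}W`, `S = C^K_{(Λ,Λ']}`, is `12·Σ_{(q,σ)} ŝ(ω_q, e_K(q⃗))·kernel₄ W (X, ψ̂⁻_{qσ}, ψ̂⁺_{qσ})` with `ŝ = sliceSymbolFnXi (βL²) 0 Λ Λ'` and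
`e_K = nambuXiCT L μ K`. -/
theorem kernel_two_grassmannLaplacian_hubbardCovSliceCT {β : ℝ} (hβ : β ≠ 0) (μ : ℝ) (K : TrigPolyC4v) (Λ Λ' : ℝ) (W : HubbardGrassmann L M)
    (X : Fin 2 → HubbardFieldIdx L M) :
    kernel ℂ (grassmannLaplacian ℂ (hubbardCovSliceCT L M β μ 0 K Λ Λ') W) 2 X =
      12 * ∑ p : FreqMomentum L M × Fin 2,
        sliceSymbolFnXi (β * (L : ℝ) ^ 2) 0 Λ Λ' (matsubaraFreq β M p.1.1) (nambuXiCT L μ K p.1.2) *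
          kernel ℂ W (2 + 2) (Fin.snoc (Fin.snoc X ((p, 1) : HubbardFieldIdx L M) : Fin (2 + 1) → HubbardFieldIdx L M) (p, 0)) := by
  rw [hubbardCovSliceCT_eq_normalCovariance_sliceSymbolFnXi hβ μ K Λ Λ', kernel_grassmannLaplacian_normalCovariance']
  norm_num

/-- **THE INCREMENT IDENTITY at a fixed frame** (`β ≠ 0`, `Z^K_{Λ_n} ≠ 0`): for every two-leg string `X`,
`kernel₂(𝒱_{n+1}[K]) X − kernel₂(𝒱_n[K]) X = 12·Σ_{(q,σ)} ŝ_{n+1}(ω_q, e_K(q⃗))·kernel₄(𝒱_n[K])(X, ψ̂⁻_{qσ}, ψ̂⁺_{qσ})`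
`+ kernel₂(e^{Δ_S}𝒱_n[K] − 𝒱_n[K] − Δ_S 𝒱_n[K]) X + kernel₂(effAction S 𝒱_n[K] − e^{Δ_S}𝒱_n[K]) X`, `S = S_{n+1}[K]` — tadpole of the slice propagator (a
function of the level `e_K`) on the INPUT four-leg kernel, plus the two remainders (≥ 2 self-lines; ≥ 2 vertices). -/
theorem kernel_two_klEffectiveAction_succ_sub_eq {β : ℝ} (hβ : β ≠ 0) (U μ : ℝ) (K : TrigPolyC4v) (n : ℕ)
    (hZ : hubbardEffPartitionFnCT L M β U μ 0 K (klScale klE0 n) ≠ 0) (X : Fin 2 → HubbardFieldIdx L M) :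
    kernel ℂ (klEffectiveAction L M β U μ K klE0 (n + 1)) 2 X - kernel ℂ (klEffectiveAction L M β U μ K klE0 n) 2 X =
      12 * ∑ p : FreqMomentum L M × Fin 2,
          sliceSymbolFnXi (β * (L : ℝ) ^ 2) 0 (klScale klE0 (n + 1)) (klScale klE0 n) (matsubaraFreq β M p.1.1) (nambuXiCT L μ K p.1.2) *
            kernel ℂ (klEffectiveAction L M β U μ K klE0 n) (2 + 2)
              (Fin.snoc (Fin.snoc X ((p, 1) : HubbardFieldIdx L M) : Fin (2 + 1) → HubbardFieldIdx L M) (p, 0)) +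
        kernel ℂ (gaussConv ℂ (hubbardCovSliceCT L M β μ 0 K (klScale klE0 (n + 1)) (klScale klE0 n)) (klEffectiveAction L M β U μ K klE0 n) -
            klEffectiveAction L M β U μ K klE0 n -
            grassmannLaplacian ℂ (hubbardCovSliceCT L M β μ 0 K (klScale klE0 (n + 1)) (klScale klE0 n))
              (klEffectiveAction L M β U μ K klE0 n)) 2 X +
        kernel ℂ (effAction ℂ (hubbardCovSliceCT L M β μ 0 K (klScale klE0 (n + 1)) (klScale klE0 n)) (klEffectiveAction L M β U μ K klE0 n) -
            gaussConv ℂ (hubbardCovSliceCT L M β μ 0 K (klScale klE0 (n + 1)) (klScale klE0 n)) (klEffectiveAction L M β U μ K klE0 n)) 2 X := by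
  rw [klEffectiveAction_succ_eq_effAction_slice β U μ K klE0 n hZ, kernel_effAction_sub_split,
    kernel_two_grassmannLaplacian_hubbardCovSliceCT hβ]

/-- **The increment identity with the tadpole keyed on the OUTPUT four-leg kernel** `kernel₄(𝒱_{n+1}[K])`: the swap term
`−12·Σ ŝ_{n+1}·kernel₄(𝒱_{n+1}[K] − 𝒱_n[K])` joins the remainder (exact, by linearity). -/
theorem kernel_two_klEffectiveAction_succ_sub_eq' {β : ℝ} (hβ : β ≠ 0) (U μ : ℝ) (K : TrigPolyC4v) (n : ℕ)
    (hZ : hubbardEffPartitionFnCT L M β U μ 0 K (klScale klE0 n) ≠ 0) (X : Fin 2 → HubbardFieldIdx L M) :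
    kernel ℂ (klEffectiveAction L M β U μ K klE0 (n + 1)) 2 X - kernel ℂ (klEffectiveAction L M β U μ K klE0 n) 2 X =
      12 * ∑ p : FreqMomentum L M × Fin 2,
          sliceSymbolFnXi (β * (L : ℝ) ^ 2) 0 (klScale klE0 (n + 1)) (klScale klE0 n) (matsubaraFreq β M p.1.1) (nambuXiCT L μ K p.1.2) *
            kernel ℂ (klEffectiveAction L M β U μ K klE0 (n + 1)) (2 + 2)
              (Fin.snoc (Fin.snoc X ((p, 1) : HubbardFieldIdx L M) : Fin (2 + 1) → HubbardFieldIdx L M) (p, 0)) -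
        12 * ∑ p : FreqMomentum L M × Fin 2,
          sliceSymbolFnXi (β * (L : ℝ) ^ 2) 0 (klScale klE0 (n + 1)) (klScale klE0 n) (matsubaraFreq β M p.1.1) (nambuXiCT L μ K p.1.2) *
            kernel ℂ (klEffectiveAction L M β U μ K klE0 (n + 1) - klEffectiveAction L M β U μ K klE0 n) (2 + 2)
              (Fin.snoc (Fin.snoc X ((p, 1) : HubbardFieldIdx L M) : Fin (2 + 1) → HubbardFieldIdx L M) (p, 0)) +
        kernel ℂ (gaussConv ℂ (hubbardCovSliceCT L M β μ 0 K (klScale klE0 (n + 1)) (klScale klE0 n)) (klEffectiveAction L M β U μ K klE0 n) -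
            klEffectiveAction L M β U μ K klE0 n -
            grassmannLaplacian ℂ (hubbardCovSliceCT L M β μ 0 K (klScale klE0 (n + 1)) (klScale klE0 n))
              (klEffectiveAction L M β U μ K klE0 n)) 2 X +
        kernel ℂ (effAction ℂ (hubbardCovSliceCT L M β μ 0 K (klScale klE0 (n + 1)) (klScale klE0 n)) (klEffectiveAction L M β U μ K klE0 n) -
            gaussConv ℂ (hubbardCovSliceCT L M β μ 0 K (klScale klE0 (n + 1)) (klScale klE0 n)) (klEffectiveAction L M β U μ K klE0 n)) 2 X := by
  rw [kernel_two_klEffectiveAction_succ_sub_eq hβ U μ K n hZ X]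
  have hswap : ∀ p : FreqMomentum L M × Fin 2,
      kernel ℂ (klEffectiveAction L M β U μ K klE0 (n + 1) - klEffectiveAction L M β U μ K klE0 n) (2 + 2)
          (Fin.snoc (Fin.snoc X ((p, 1) : HubbardFieldIdx L M) : Fin (2 + 1) → HubbardFieldIdx L M) (p, 0)) =
        kernel ℂ (klEffectiveAction L M β U μ K klE0 (n + 1)) (2 + 2)
            (Fin.snoc (Fin.snoc X ((p, 1) : HubbardFieldIdx L M) : Fin (2 + 1) → HubbardFieldIdx L M) (p, 0)) -
          kernel ℂ (klEffectiveAction L M β U μ K klE0 n) (2 + 2)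
            (Fin.snoc (Fin.snoc X ((p, 1) : HubbardFieldIdx L M) : Fin (2 + 1) → HubbardFieldIdx L M) (p, 0)) :=
    fun p => by rw [kernel_sub']
  simp_rw [hswap, mul_sub, Finset.sum_sub_distrib]
  ring

end Model

/-! ## §3 The scale-`0` base at a fixed frame `K` -/

section Base

variable {L M : ℕ} [NeZero L]

/-- The two-leg kernel of the countertermed vertex is the counterterm's: `kernel (V_U + 𝒩_K) 2 = kernel 𝒩_K 2` (the Hubbard vertex is quartic). -/
theorem kernel_two_hubbardInteractionCT (β U : ℝ) (K : TrigPolyC4v) (X : Fin 2 → HubbardFieldIdx L M) :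
    kernel ℂ (hubbardInteractionCT L M β U K) 2 X = kernel ℂ (counterQuadratic L M β K) 2 X := by
  rw [hubbardInteractionCT, kernel_add, kernel_hubbardInteraction_of_ne_four β U (by norm_num) X, zero_add]

/-- **THE TADPOLE OF THE ABOVE-SCALE COVARIANCE ON THE COUNTERTERMED VERTEX** (`β ≠ 0`, any frame, any cutoff): only the bare Hubbard vertex contributes
(Hartree), `kernel₂(Δ_{C^K_{>Λ}}(V_U + 𝒩_K))(X) = 12·Σ_{(q,σ)} ĉ^K_{>Λ}(q)·kernel₄ V_U (X, ψ̂⁻_{qσ}, ψ̂⁺_{qσ})`, `ĉ^K_{>Λ}(q) = w^K_Λ(q)·βL²·(iω_q + e_K(q⃗))/nambuDenCT`. -/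
theorem kernel_two_grassmannLaplacian_hubbardCovAboveCT_interactionCT (β U μ : ℝ) (K : TrigPolyC4v) (Λ : ℝ)
    (X : Fin 2 → HubbardFieldIdx L M) :
    kernel ℂ (grassmannLaplacian ℂ (hubbardCovAboveCT L M β μ 0 K Λ) (hubbardInteractionCT L M β U K)) 2 X =
      12 * ∑ p : FreqMomentum L M × Fin 2,
        ((hubbardCutoffWeightCT L M β μ K Λ p.1 : ℂ) *
            (((β * (L : ℝ) ^ 2 : ℝ) : ℂ) * ((Complex.I * matsubaraFreq β M p.1.1 + nambuXiCT L μ K p.1.2) / nambuDenCT L M β μ 0 K p.1))) *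
          kernel ℂ (hubbardInteraction L M β U) (2 + 2)
            (Fin.snoc (Fin.snoc X ((p, 1) : HubbardFieldIdx L M) : Fin (2 + 1) → HubbardFieldIdx L M) (p, 0)) := by
  rw [hubbardCovAboveCT_zero_seed β μ K Λ, kernel_grassmannLaplacian_normalCovariance']
  have h4 : ∀ Y : Fin (2 + 2) → HubbardFieldIdx L M, kernel ℂ (hubbardInteractionCT L M β U K) (2 + 2) Y = kernel ℂ (hubbardInteraction L M β U) (2 + 2) Y :=
    fun Y => kernel_hubbardInteractionCT_four β U K Y
  simp_rw [h4]
  norm_num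

/-- **THE SCALE-`0` BASE at a fixed frame** (`β ≠ 0`): `kernel₂(𝒱_0[K]) X − kernel₂(𝒩_K) X = 12·Σ_{(q,σ)} ĉ^K_{>Λ_0}(q)·kernel₄ V_U (X, ψ̂⁻_{qσ}, ψ̂⁺_{qσ})`
`+ kernel₂(e^{Δ_C}V_K − V_K − Δ_C V_K) X + kernel₂(effAction C V_K − e^{Δ_C}V_K) X`, `C = C^K_{>Λ_0}`, `V_K = V_U + 𝒩_K`, `Λ_0 = klScale klE0 0`. -/
theorem kernel_two_klEffectiveAction_zero_sub_counter_eq (β U μ : ℝ) (K : TrigPolyC4v) (X : Fin 2 → HubbardFieldIdx L M) :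
    kernel ℂ (klEffectiveAction L M β U μ K klE0 0) 2 X - kernel ℂ (counterQuadratic L M β K) 2 X =
      12 * ∑ p : FreqMomentum L M × Fin 2,
          ((hubbardCutoffWeightCT L M β μ K (klScale klE0 0) p.1 : ℂ) *
              (((β * (L : ℝ) ^ 2 : ℝ) : ℂ) * ((Complex.I * matsubaraFreq β M p.1.1 + nambuXiCT L μ K p.1.2) / nambuDenCT L M β μ 0 K p.1))) *
            kernel ℂ (hubbardInteraction L M β U) (2 + 2)
              (Fin.snoc (Fin.snoc X ((p, 1) : HubbardFieldIdx L M) : Fin (2 + 1) → HubbardFieldIdx L M) (p, 0)) +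
        kernel ℂ (gaussConv ℂ (hubbardCovAboveCT L M β μ 0 K (klScale klE0 0)) (hubbardInteractionCT L M β U K) -
            hubbardInteractionCT L M β U K -
            grassmannLaplacian ℂ (hubbardCovAboveCT L M β μ 0 K (klScale klE0 0)) (hubbardInteractionCT L M β U K)) 2 X +
        kernel ℂ (effAction ℂ (hubbardCovAboveCT L M β μ 0 K (klScale klE0 0)) (hubbardInteractionCT L M β U K) -
            gaussConv ℂ (hubbardCovAboveCT L M β μ 0 K (klScale klE0 0)) (hubbardInteractionCT L M β U K)) 2 X := by
  rw [← kernel_two_hubbardInteractionCT β U K X, klEffectiveAction, hubbardEffectiveActionCT_def, kernel_effAction_sub_split,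
    kernel_two_grassmannLaplacian_hubbardCovAboveCT_interactionCT]

end Base

/-! ## §4 (append, r2d-p1 g6) Second order made explicit: the two-vertex term by name, third-order tail -/

section SecondOrder

variable {𝕜 : Type*} [RCLike 𝕜] {Γ : Type*} [Fintype Γ]

/-- **The degree-`m` kernel of `effAction C W`, split to SECOND order**: input · one line · ≥ 2 self-lines · the explicit TWO-VERTEX term
`−½·kernel (e^{Δ_C}(W·W) − e^{Δ_C}W · e^{Δ_C}W)` (the second truncated cumulant) · the THIRD-order tail `kernel (effAction C W − e^{Δ_C}W + ½(e^{Δ_C}(W²) − (e^{Δ_C}W)²))`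
(bounded BY NAME: Literature `sum_norm_kernel_effAction_sub_secondOrder_le` / its weighted twin). -/
theorem kernel_effAction_split₃ (C : Matrix Γ Γ 𝕜) (W : GrassmannAlgebra 𝕜 Γ) (m : ℕ) (X : Fin m → Γ) :
    kernel 𝕜 (effAction 𝕜 C W) m X =
      kernel 𝕜 W m X + kernel 𝕜 (grassmannLaplacian 𝕜 C W) m X +
        kernel 𝕜 (gaussConv 𝕜 C W - W - grassmannLaplacian 𝕜 C W) m X -
          kernel 𝕜 ((2 : 𝕜)⁻¹ • (gaussConv 𝕜 C (W * W) - gaussConv 𝕜 C W * gaussConv 𝕜 C W)) m X +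
            kernel 𝕜 (effAction 𝕜 C W - gaussConv 𝕜 C W +
              (2 : 𝕜)⁻¹ • (gaussConv 𝕜 C (W * W) - gaussConv 𝕜 C W * gaussConv 𝕜 C W)) m X := by
  rw [kernel_add, kernel_sub', kernel_sub', kernel_sub']
  ring

end SecondOrder

section ModelSecondOrder

variable {L M : ℕ} [NeZero L]

/-- **THE INCREMENT IDENTITY TO SECOND ORDER at a fixed frame** (`β ≠ 0`, `Z^K_{Λ_n} ≠ 0`): `kernel₂(𝒱_{n+1}[K]) X − kernel₂(𝒱_n[K]) X =`
tadpole (`12·Σ ŝ_{n+1}·kernel₄(𝒱_n[K])(X,ψ̂⁻,ψ̂⁺)`) `+ kernel₂(e^{Δ_S}𝒱_n − 𝒱_n − Δ_S𝒱_n) X` (≥ 2 self-lines)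
`− kernel₂(½(e^{Δ_S}(𝒱_n·𝒱_n) − e^{Δ_S}𝒱_n·e^{Δ_S}𝒱_n)) X` (ALL two-vertex graphs, ≥ 1 slice line) `+ kernel₂(T₃) X` (third-order tail), `S = S_{n+1}[K]`. -/
theorem kernel_two_klEffectiveAction_succ_sub_eq₃ {β : ℝ} (hβ : β ≠ 0) (U μ : ℝ) (K : TrigPolyC4v) (n : ℕ)
    (hZ : hubbardEffPartitionFnCT L M β U μ 0 K (klScale klE0 n) ≠ 0) (X : Fin 2 → HubbardFieldIdx L M) :
    kernel ℂ (klEffectiveAction L M β U μ K klE0 (n + 1)) 2 X - kernel ℂ (klEffectiveAction L M β U μ K klE0 n) 2 X =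
      12 * ∑ p : FreqMomentum L M × Fin 2,
          sliceSymbolFnXi (β * (L : ℝ) ^ 2) 0 (klScale klE0 (n + 1)) (klScale klE0 n) (matsubaraFreq β M p.1.1) (nambuXiCT L μ K p.1.2) *
            kernel ℂ (klEffectiveAction L M β U μ K klE0 n) (2 + 2)
              (Fin.snoc (Fin.snoc X ((p, 1) : HubbardFieldIdx L M) : Fin (2 + 1) → HubbardFieldIdx L M) (p, 0)) +
        kernel ℂ (gaussConv ℂ (hubbardCovSliceCT L M β μ 0 K (klScale klE0 (n + 1)) (klScale klE0 n)) (klEffectiveAction L M β U μ K klE0 n) -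
            klEffectiveAction L M β U μ K klE0 n -
            grassmannLaplacian ℂ (hubbardCovSliceCT L M β μ 0 K (klScale klE0 (n + 1)) (klScale klE0 n))
              (klEffectiveAction L M β U μ K klE0 n)) 2 X -
        kernel ℂ ((2 : ℂ)⁻¹ •
            (gaussConv ℂ (hubbardCovSliceCT L M β μ 0 K (klScale klE0 (n + 1)) (klScale klE0 n))
                (klEffectiveAction L M β U μ K klE0 n * klEffectiveAction L M β U μ K klE0 n) -
              gaussConv ℂ (hubbardCovSliceCT L M β μ 0 K (klScale klE0 (n + 1)) (klScale klE0 n)) (klEffectiveAction L M β U μ K klE0 n) *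
                gaussConv ℂ (hubbardCovSliceCT L M β μ 0 K (klScale klE0 (n + 1)) (klScale klE0 n)) (klEffectiveAction L M β U μ K klE0 n))) 2 X +
        kernel ℂ (effAction ℂ (hubbardCovSliceCT L M β μ 0 K (klScale klE0 (n + 1)) (klScale klE0 n)) (klEffectiveAction L M β U μ K klE0 n) -
            gaussConv ℂ (hubbardCovSliceCT L M β μ 0 K (klScale klE0 (n + 1)) (klScale klE0 n)) (klEffectiveAction L M β U μ K klE0 n) +
            (2 : ℂ)⁻¹ •
              (gaussConv ℂ (hubbardCovSliceCT L M β μ 0 K (klScale klE0 (n + 1)) (klScale klE0 n))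
                  (klEffectiveAction L M β U μ K klE0 n * klEffectiveAction L M β U μ K klE0 n) -
                gaussConv ℂ (hubbardCovSliceCT L M β μ 0 K (klScale klE0 (n + 1)) (klScale klE0 n)) (klEffectiveAction L M β U μ K klE0 n) *
                  gaussConv ℂ (hubbardCovSliceCT L M β μ 0 K (klScale klE0 (n + 1)) (klScale klE0 n)) (klEffectiveAction L M β U μ K klE0 n))) 2 X := by
  rw [klEffectiveAction_succ_eq_effAction_slice β U μ K klE0 n hZ, kernel_effAction_split₃,
    kernel_two_grassmannLaplacian_hubbardCovSliceCT hβ]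
  ring

end ModelSecondOrder

end Summit.HubbardSuperconductivity.HubbardSuperconductivity.Theorems.KLRegimeSplit

end
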